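import Summits.QuantumFields.BalabanUV.T4Continuum.Spine.NE1p.DressedRebornMuResponse
import Summits.QuantumFields.BalabanUV.T4Continuum.Spine.NE1p.DressedSmallFieldGeometryFaces

/-!
# T⁴ programme, spine estimate NE1′ (node O3b/H2) — THE RE-BORN μ-PART AND ITS LINEAR RESPONSE ON THE TORUS: S56 §2∕§3 and S61 §2∕§3
# at pv22's `tgeometry 4 N` — NO geometry hypothesis, located numerals `(ν, c₁, K₀) = (9, 64, K₀(64,8))`, `κ₀ = 64·log 162`,
# `d = torusTreeLen`; S52-B ∕ S58's torus-column pattern VERBATIM for the DRESSED (bilinear) regeneration END in both faces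

Cell `pub-balaban`, sub-cell `t4`, BINDER-OWNERS row NE1′; NE1′ formalisation crew, unit `b2b-balaban-t4-ne1p-formalise-leaf-03`
(LEAF PROVER 03, generation 14); crew row S64 ∕ DAG N29zzzzzg of `t4/formal/NE1p/LEAVES.md`
(BOOKED typer R-T151; filed under RULE (f.4) R-T155; read X237 ok) (own-lineage torus column of S56 `DressedRebornMuPart`
(p239964) and S61 `DressedRebornMuResponse` (p243273), exactly as S52-B is S52-A's and S58 is S55's).  ADDITIVE — imports S61
`Spine/NE1p/DressedRebornMuResponse` (→ S56 → S33 → N0j ∕ N0r ∕ row NE5) + S24 `Spine/NE1p/DressedSmallFieldGeometryFaces` (pv22's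
`tgeometry`, `torus_consts`, `K₀_four`) ONLY; THEOREMS ONLY (4 thm, 0 def, 0 `def … : Prop`, 0 cite); nothing restated.

WHY THIS FILE.  The decided witnesses of the dressed END (W84 ∕ W86 ∕ W87, and the response witness now staged by leaf-06) each
re-locate pv22's numerals by hand (`torus_consts` ∕ `K₀_four` rewrites inside every witness).  The column's other ENDs have torus forms of
record (S24 §2; S31; S50-A; S52-B; S58) that deliver the conclusion at `tsys 4 N` ∕ `tgeometry 4 N` with the numerals LOCATED and no
`Geometry` binder; the re-born μ-part (S56) and its response (S61) had none.  Here, S52-B's substitution VERBATIM («module §k ↦ S56∕S61 §k,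
`b₅ := 5·r₁`, `rw [hν, hc, hK₀] at h; exact h`»):
* §0 `rebornMuPart_locE_le_of_expLinear_torus` (S56 §2 ONCE) and §1 `rebornMuPart_locE_le_of_coresAt_bipencil_mass_torus` (S56 §3 ONCE):
  the mixed difference over `{0, μ} × {0, 1}` `≤ 2·((2·(e·9·64·K₀(64,8)²·A·e^{−r₁·torusTreeLen X₀}))∕μ₁·‖μ‖)∕ε·σ` (resp. `·‖v‖`);
* §2 `rebornMuDeriv_locE_le_of_expLinear_torus` (S61 §2 ONCE) and §3 `rebornMuDeriv_locE_le_of_coresAt_bipencil_mass_torus` (S61 §3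
  ONCE): `‖∂_m (E[act(m,1)](X₀) − E[act(m,0)](X₀))|_{μ}‖ ≤ 2·((2·(e·9·64·K₀(64,8)²·A·e^{−r₁·torusTreeLen X₀}))∕ε·σ)∕(μ₁ − μ₀)`.
ALL conclusions pin `locE (Dom := (tsys 4 N).Dom) (TTouch …) (fun Z => Z.1)` (S31 ∕ S50-A ∕ S52-B's elaboration note).

WHAT STAYS DISPLAYED (binders, by name; NOTHING instantiated on Bałaban's densities): as in S56∕S61 minus the geometry — the exp-linear
FORMAT datum `hexp` resp. the cores `𝔊` with their Gaussian letter blocks; `hroom`; `hO`∕`hH`; (B1b)'s residue `terms`∕`emb`∕`hscale`;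
the torus clause numerals `r₁ + 2·(64·log 162) + 2 ≤ R`, `A·e^{5r₁+1}·K₀(64,8)·9·64 ≤ 1`; (B3) = `hL3`∕`hM3` (G-ne9p2-5, UNPRINTED,
shared with NE9, a BINDER); the source radius∕window and the content's room.  The located constants are READINGS of the dressed (w5)
constant and of its response at pv22's torus geometry ((B4) BY NAME, pv22's READING D-pv22.3) — (B1a) discharged at the cores, (w5)∕(w6)
NOT discharged on Bałaban's densities.

HONEST FRAMING.  By-name specialisation over SHAPES at pv22's CONSTRUCTED torus geometry; (B1a) relocated onto row NE5's exp-linear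
FORMAT hypothesis — identification with Bałaban's (2.14) = the substrate's DISPLAYED reading, NOT claimed; (B1b) ∕ (B3) ∕ (B5) NOT
discharged; 0 binders instantiated on Bałaban's densities; no new inequality; no wall item of NE1′ or NE5 moves; the NE1′ wall wording
of record v1.8 (T4-DAG v48) — words, not kind — does NOT move; R-t4r2-Q2 NOT met; ABSOLUTE RULE honoured ([folklore] kernel lemmas
only; no numeral of print; no disputed step of the audited manuscripts enters as a fact).  NE1′ ⇐ the named binders — NOT proved, NOT
printed; spine PROVED 0∕9; count 9 unchanged.  Rung (B)+1 on ONE finite four-torus — NOT infinite volume, NOT a mass gap, NOT OS on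
ℝ⁴, NOT Clay.  HONEST DEPENDENCY: continuum YM on T⁴ ⇐ BetaPertH ∧ nine spine estimates (0/9 proved); BetaPertH ⇐ (D1) ∧ (D4) ∧
CAP+tail; G-an2-4 gates asym, D1 and NE2/3/4.
-/

noncomputable section

namespace Summit.QuantumFields.BalabanUV.T4Continuum.NE1p.DressedRebornMuPartTorus

open scoped BigOperators
open Metric Set MeasureTheory
open Literature.MathematicalPhysics.QuantumFieldTheory.Balaban1983to89
open Literature.MathematicalPhysics.QuantumFieldTheory.Balaban1983to89.T4OutputRate (Carriers)
open Literature.MathematicalPhysics.QuantumFieldTheory.Balaban1983to89.B13Resummation (locE)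
open Literature.MathematicalPhysics.QuantumFieldTheory.Balaban1983to89.TreeLengthTorus (tsys torusTreeLen)
open Literature.MathematicalPhysics.QuantumFieldTheory.Balaban1983to89.TreeLengthTorusGeometry (TTouch tgeometry)
open Literature.MathematicalPhysics.QuantumFieldTheory.Balaban1983to89.B12TreeDecay (K₀)
open Literature.MathematicalPhysics.QuantumFieldTheory.Balaban1983to89.T4InputCauchyRateTermwise (TermHistExpLinear)
open Summit.QuantumFields.BalabanUV.T4Continuum.B13HistMeasurable (MeasPotFrame B13HistM)
open Summit.QuantumFields.BalabanUV.T4Continuum.B13TermParamGaussianBi (BiCore)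
open Summit.QuantumFields.BalabanUV.T4Continuum.NE1p.DressedRebornMuPart (rebornMuPart_locE_le_of_expLinear
  rebornMuPart_locE_le_of_coresAt_bipencil_mass)
open Summit.QuantumFields.BalabanUV.T4Continuum.NE1p.DressedRebornMuResponse (rebornMuDeriv_locE_le_of_expLinear
  rebornMuDeriv_locE_le_of_coresAt_bipencil_mass)
open Summit.QuantumFields.BalabanUV.T4Continuum.NE1p.DressedSmallFieldGeometry (torus_consts)
open Summit.QuantumFields.BalabanUV.T4Continuum.NE1p.DressedSmallFieldGeometryFaces (K₀_four)

variable {N : ℕ} [NeZero N]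

section ExpLinear

variable {C : Carriers} {Op Hist : Type*} [NormedAddCommGroup Hist] [NormedSpace ℂ Hist] {ι : Type*}
  {K : ℕ → (ℕ → ℝ) → C.BgB → Set (Op × Hist)} {T : ℕ → ι → Op → Hist → C.Dom → ℂ}
  {W : Set (ℕ → ℝ)} {α : ℕ → ι → Type*} [∀ k i, MeasurableSpace (α k i)] {μm : ∀ k i, Op → C.Dom → Measure (α k i)}
  {Φ : ∀ k i, Op → C.Dom → α k i → ℂ} {Λ : ∀ k i, Op → C.Dom → α k i → (Hist →L[ℂ] ℂ)}

/-! ## §0 THE RE-BORN μ-PART OF EXP-LINEAR FAMILIES ALONG A TABLE MAP OF (SOURCE, STRENGTH), ON THE TORUS -/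

open Classical in
/-- **THE RE-BORN μ-PART, (B1a) DISCHARGED, ON THE TORUS — NO GEOMETRY HYPOTHESIS** (kernel; S56 §2 `rebornMuPart_locE_le_of_expLinear`
ONCE BY NAME at `tsys 4 N` ∕ `tgeometry 4 N`, `b₅ := 5·r₁`, constants located by `torus_consts` ∕ `K₀_four`). [folklore] -/
theorem rebornMuPart_locE_le_of_expLinear_torus (hexp : TermHistExpLinear K T W μm Φ Λ) {k : ℕ} {g : ℕ → ℝ} (hg : g ∈ W)
    {U : C.BgB} {o : Op} {hc : ℂ × ℂ → Hist} {μ₁ σ ε R₀ : ℝ} (hσ : 0 < σ) (hσε : σ < ε)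
    (hcurve : DifferentiableOn ℂ hc (ball (0 : ℂ) μ₁ ×ˢ ball (0 : ℂ) (ε / σ)))
    (hK : ∀ z ∈ ball (0 : ℂ) μ₁ ×ˢ ball (0 : ℂ) (ε / σ), (o, hc z) ∈ K k g U)
    (hR : ∀ z ∈ ball (0 : ℂ) μ₁ ×ˢ ball (0 : ℂ) (ε / σ), ‖hc z‖ ≤ R₀)
    {emb : (tsys 4 N).Dom → C.Dom} (hscale : ∀ Z, C.scale (emb Z) = k) {terms : (tsys 4 N).Dom → Finset ι} {act : ℂ × ℂ → (tsys 4 N).Dom → ℂ}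
    (hact : ∀ z ∈ ball (0 : ℂ) μ₁ ×ˢ ball (0 : ℂ) (ε / σ), ∀ Z, act z Z = ∑ i ∈ terms Z, T k i o (hc z) (emb Z))
    {N' : (tsys 4 N).Dom → ι → ℝ} (hN0 : ∀ Z i, 0 ≤ N' Z i) (hN : ∀ Z, ∀ i ∈ terms Z, ∀ᵐ a ∂μm k i o (emb Z), ‖Λ k i o (emb Z) a‖ ≤ N' Z i)
    {A R r₁ : ℝ} (X₀ : (tsys 4 N).Dom) (hA : 0 ≤ A) (hr₁ : 0 ≤ r₁)
    (hrate : r₁ + 2 * (64 * Real.log 162) + 2 ≤ R) (hsmall : A * Real.exp (5 * r₁ + 1) * K₀ 64 8 * 9 * 64 ≤ 1) (hL3 : ∀ Z : (tsys 4 N).Dom, Z.1 ⊆ X₀.1 →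
      ∑ i ∈ terms Z, (∫ a, ‖Φ k i o (emb Z) a‖ ∂μm k i o (emb Z)) * Real.exp (N' Z i * R₀) ≤ A * Real.exp (-(R * torusTreeLen Z.1)))
    {μ : ℂ} (hμ : μ ∈ ball (0 : ℂ) μ₁) :
    ‖locE (Dom := (tsys 4 N).Dom) (TTouch (d := 4) (N := N)) (fun Z : (tsys 4 N).Dom => Z.1) (act (μ, 1)) X₀.1 -
          locE (Dom := (tsys 4 N).Dom) (TTouch (d := 4) (N := N)) (fun Z : (tsys 4 N).Dom => Z.1) (act (0, 1)) X₀.1 -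
        (locE (Dom := (tsys 4 N).Dom) (TTouch (d := 4) (N := N)) (fun Z : (tsys 4 N).Dom => Z.1) (act (μ, 0)) X₀.1 -
          locE (Dom := (tsys 4 N).Dom) (TTouch (d := 4) (N := N)) (fun Z : (tsys 4 N).Dom => Z.1) (act (0, 0)) X₀.1)‖ ≤
      2 * (2 * (Real.exp 1 * 9 * 64 * K₀ 64 8 ^ 2 * A * Real.exp (-(r₁ * torusTreeLen X₀.1))) / μ₁ * ‖μ‖) / ε * σ   := by
  obtain ⟨hν, hκ, hc'⟩ := torus_consts N
  have hK₀ := K₀_four (N := N)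
  have h := rebornMuPart_locE_le_of_expLinear (tsys 4 N) (tgeometry 4 N) hexp hg hσ hσε hcurve hK hR hscale hact hN0 hN
    (R := R) (b₅ := 5 * r₁) (X₀ := X₀) hA hr₁ (le_of_eq (by ring)) (by rw [hκ]; exact hrate)
    (by rw [hK₀, hν, hc']; exact hsmall) hL3 hμ
  rw [hν, hc', hK₀] at h
  exact h

/-! ## §2 THE RESPONSE OF THE RE-BORN PART OF EXP-LINEAR FAMILIES, ON THE TORUS -/

open Classical in
/-- **THE RESPONSE OF THE RE-BORN PART, (B1a) DISCHARGED, ON THE TORUS — NO GEOMETRY HYPOTHESIS** (kernel; S61 §2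
`rebornMuDeriv_locE_le_of_expLinear` ONCE BY NAME at `tsys 4 N` ∕ `tgeometry 4 N`, `b₅ := 5·r₁`, `torus_consts` ∕ `K₀_four`). [folklore] -/
theorem rebornMuDeriv_locE_le_of_expLinear_torus (hexp : TermHistExpLinear K T W μm Φ Λ) {k : ℕ} {g : ℕ → ℝ} (hg : g ∈ W)
    {U : C.BgB} {o : Op} {hc : ℂ × ℂ → Hist} {μ₁ σ ε R₀ : ℝ} (hσ : 0 < σ) (hσε : σ < ε)
    (hcurve : DifferentiableOn ℂ hc (ball (0 : ℂ) μ₁ ×ˢ ball (0 : ℂ) (ε / σ)))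
    (hK : ∀ z ∈ ball (0 : ℂ) μ₁ ×ˢ ball (0 : ℂ) (ε / σ), (o, hc z) ∈ K k g U)
    (hR : ∀ z ∈ ball (0 : ℂ) μ₁ ×ˢ ball (0 : ℂ) (ε / σ), ‖hc z‖ ≤ R₀)
    {emb : (tsys 4 N).Dom → C.Dom} (hscale : ∀ Z, C.scale (emb Z) = k) {terms : (tsys 4 N).Dom → Finset ι} {act : ℂ × ℂ → (tsys 4 N).Dom → ℂ}
    (hact : ∀ z ∈ ball (0 : ℂ) μ₁ ×ˢ ball (0 : ℂ) (ε / σ), ∀ Z, act z Z = ∑ i ∈ terms Z, T k i o (hc z) (emb Z))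
    {N' : (tsys 4 N).Dom → ι → ℝ} (hN0 : ∀ Z i, 0 ≤ N' Z i) (hN : ∀ Z, ∀ i ∈ terms Z, ∀ᵐ a ∂μm k i o (emb Z), ‖Λ k i o (emb Z) a‖ ≤ N' Z i)
    {A R r₁ : ℝ} (X₀ : (tsys 4 N).Dom) (hA : 0 ≤ A) (hr₁ : 0 ≤ r₁)
    (hrate : r₁ + 2 * (64 * Real.log 162) + 2 ≤ R) (hsmall : A * Real.exp (5 * r₁ + 1) * K₀ 64 8 * 9 * 64 ≤ 1) (hL3 : ∀ Z : (tsys 4 N).Dom, Z.1 ⊆ X₀.1 →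
      ∑ i ∈ terms Z, (∫ a, ‖Φ k i o (emb Z) a‖ ∂μm k i o (emb Z)) * Real.exp (N' Z i * R₀) ≤ A * Real.exp (-(R * torusTreeLen Z.1)))
    {μ₀ : ℝ} (h01 : μ₀ < μ₁) {μ : ℂ} (hμ : ‖μ‖ ≤ μ₀) :
    ‖deriv (fun m : ℂ =>
        locE (Dom := (tsys 4 N).Dom) (TTouch (d := 4) (N := N)) (fun Z : (tsys 4 N).Dom => Z.1) (act (m, 1)) X₀.1 -
          locE (Dom := (tsys 4 N).Dom) (TTouch (d := 4) (N := N)) (fun Z : (tsys 4 N).Dom => Z.1) (act (m, 0)) X₀.1) μ‖ ≤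
      2 * (2 * (Real.exp 1 * 9 * 64 * K₀ 64 8 ^ 2 * A * Real.exp (-(r₁ * torusTreeLen X₀.1))) / ε * σ) / (μ₁ - μ₀)   := by
  obtain ⟨hν, hκ, hc'⟩ := torus_consts N
  have hK₀ := K₀_four (N := N)
  have h := rebornMuDeriv_locE_le_of_expLinear (tsys 4 N) (tgeometry 4 N) hexp hg hσ hσε hcurve hK hR hscale hact hN0 hN
    (R := R) (b₅ := 5 * r₁) (X₀ := X₀) hA hr₁ (le_of_eq (by ring)) (by rw [hκ]; exact hrate)
    (by rw [hK₀, hν, hc']; exact hsmall) hL3 h01 hμ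
  rw [hν, hc', hK₀] at h
  exact h

end ExpLinear

section Dep

variable {C : Carriers} {P : MeasPotFrame C} {Op : Type*} [NormedAddCommGroup Op] [NormedSpace ℂ Op] {ι : Type*}
  {𝒴 : ℕ → ι → Type*} {dom : ∀ k i, 𝒴 k i → C.Dom} {β : ℕ → ι → Type*} [∀ k i, MeasurableSpace (β k i)]
  {α : ℕ → ι → Type*} [∀ k i, NormedAddCommGroup (α k i)] [∀ k i, InnerProductSpace ℝ (α k i)]
  [∀ k i, FiniteDimensional ℝ (α k i)] [∀ k i, MeasurableSpace (α k i)] [∀ k i, BorelSpace (α k i)]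

/-! ## §1 THE RE-BORN μ-PART FOR CORES ALONG THE BI-PENCIL, ON THE TORUS -/

open Classical in
/-- **THE RE-BORN μ-PART FOR CORES WITH TERM-DEPENDENT POLYMER FAMILIES, ON THE TORUS — NO GEOMETRY HYPOTHESIS** (kernel; S56 §3
`rebornMuPart_locE_le_of_coresAt_bipencil_mass` ONCE BY NAME at `tsys 4 N` ∕ `tgeometry 4 N`, `b₅ := 5·r₁`, `torus_consts` ∕ `K₀_four`).
[folklore] -/
theorem rebornMuPart_locE_le_of_coresAt_bipencil_mass_torus {W : Set (ℕ → ℝ)}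
    {ctr : ℕ → (ℕ → ℝ) → C.BgB → Op × B13HistM P} {ROp RHist R' : ℕ → ℝ}
    (𝔊 : ∀ k i, C.Dom → BiCore P (dom k i) Op (β k i) (α k i)) {mq bq N₀ : ℕ → ι → C.Dom → ℝ} (hroom : ∀ k, ROp k < R' k)
    (hm : ∀ k, ∀ g ∈ W, ∀ (U : C.BgB) (X : C.Dom), C.scale X = k → ∀ i, 0 < mq k i X)
    (hN : ∀ k, ∀ g ∈ W, ∀ (U : C.BgB) (X : C.Dom), C.scale X = k → ∀ i,
      (∀ o ∈ ball (ctr k g U).1 (R' k), AEStronglyMeasurable ((𝔊 k i X).N o) (𝔊 k i X).lam) ∧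
      (∀ p, DifferentiableOn ℂ (fun o => (𝔊 k i X).N o p) (ball (ctr k g U).1 (R' k))) ∧
      (∀ o ∈ ball (ctr k g U).1 (R' k), ∀ p, ‖(𝔊 k i X).N o p‖ ≤ N₀ k i X))
    (hq : ∀ k, ∀ g ∈ W, ∀ (U : C.BgB) (X : C.Dom), C.scale X = k → ∀ i,
      (∀ o ∈ ball (ctr k g U).1 (R' k),
        AEStronglyMeasurable (Function.uncurry ((𝔊 k i X).q o)) ((𝔊 k i X).lam.prod volume)) ∧
      (∀ p v, DifferentiableOn ℂ (fun o => (𝔊 k i X).q o p v) (ball (ctr k g U).1 (R' k))) ∧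
      (∀ o ∈ ball (ctr k g U).1 (R' k), ∀ p v, mq k i X * ‖v‖ ^ 2 - bq k i X ≤ ((𝔊 k i X).q o p v).re))
    {k : ℕ} {g : ℕ → ℝ} (hg : g ∈ W) {U : C.BgB} {o : Op} {h₀ u v : B13HistM P} {μ₁ ε : ℝ}
    (hv : 0 < ‖v‖) (hvε : ‖v‖ < ε)
    (hO : ‖o - (ctr k g U).1‖ ≤ ROp k) (hH : ‖h₀ - (ctr k g U).2‖ + μ₁ * ‖u‖ + ε ≤ RHist k)
    {emb : (tsys 4 N).Dom → C.Dom} (hscale : ∀ Z, C.scale (emb Z) = k) {terms : (tsys 4 N).Dom → Finset ι} {act : ℂ × ℂ → (tsys 4 N).Dom → ℂ}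
    (hact : ∀ z ∈ ball (0 : ℂ) μ₁ ×ˢ ball (0 : ℂ) (ε / ‖v‖), ∀ Z,
      act z Z = ∑ i ∈ terms Z, (𝔊 k i (emb Z)).termAt o (h₀ + z.1 • u + z.2 • v))
    {A R r₁ : ℝ} (X₀ : (tsys 4 N).Dom) (hA : 0 ≤ A) (hr₁ : 0 ≤ r₁)
    (hrate : r₁ + 2 * (64 * Real.log 162) + 2 ≤ R) (hsmall : A * Real.exp (5 * r₁ + 1) * K₀ 64 8 * 9 * 64 ≤ 1) (hM3 : ∀ Z : (tsys 4 N).Dom, Z.1 ⊆ X₀.1 →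
      ∑ i ∈ terms Z, (𝔊 k i (emb Z)).lam.real univ * ((𝔊 k i (emb Z)).wB * N₀ k i (emb Z) *
          Real.exp (bq k i (emb Z))) * (Real.pi / (mq k i (emb Z) / 2)) ^ (Module.finrank ℝ (α k i) / 2 : ℝ) *
        Real.exp ((𝔊 k i (emb Z)).N₁ * (‖h₀‖ + μ₁ * ‖u‖ + ε)) ≤ A * Real.exp (-(R * torusTreeLen Z.1)))
    {μ : ℂ} (hμ : μ ∈ ball (0 : ℂ) μ₁) :
    ‖locE (Dom := (tsys 4 N).Dom) (TTouch (d := 4) (N := N)) (fun Z : (tsys 4 N).Dom => Z.1) (act (μ, 1)) X₀.1 -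
          locE (Dom := (tsys 4 N).Dom) (TTouch (d := 4) (N := N)) (fun Z : (tsys 4 N).Dom => Z.1) (act (0, 1)) X₀.1 -
        (locE (Dom := (tsys 4 N).Dom) (TTouch (d := 4) (N := N)) (fun Z : (tsys 4 N).Dom => Z.1) (act (μ, 0)) X₀.1 -
          locE (Dom := (tsys 4 N).Dom) (TTouch (d := 4) (N := N)) (fun Z : (tsys 4 N).Dom => Z.1) (act (0, 0)) X₀.1)‖ ≤
      2 * (2 * (Real.exp 1 * 9 * 64 * K₀ 64 8 ^ 2 * A * Real.exp (-(r₁ * torusTreeLen X₀.1))) / μ₁ * ‖μ‖) / ε * ‖v‖   := by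
  obtain ⟨hν, hκ, hc⟩ := torus_consts N
  have hK₀ := K₀_four (N := N)
  have h := rebornMuPart_locE_le_of_coresAt_bipencil_mass (tsys 4 N) (tgeometry 4 N) 𝔊 hroom hm hN hq hg hv hvε hO hH hscale hact
    (R := R) (b₅ := 5 * r₁) (X₀ := X₀) hA hr₁ (le_of_eq (by ring)) (by rw [hκ]; exact hrate)
    (by rw [hK₀, hν, hc]; exact hsmall) hM3 hμ
  rw [hν, hc, hK₀] at h
  exact h

/-! ## §3 THE RESPONSE OF THE RE-BORN PART FOR CORES ALONG THE BI-PENCIL, ON THE TORUS -/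

open Classical in
/-- **THE RESPONSE OF THE RE-BORN PART FOR CORES, ON THE TORUS — NO GEOMETRY HYPOTHESIS** (kernel; S61 §3
`rebornMuDeriv_locE_le_of_coresAt_bipencil_mass` ONCE BY NAME at `tsys 4 N` ∕ `tgeometry 4 N`, `b₅ := 5·r₁`, `torus_consts` ∕ `K₀_four`).
[folklore] -/
theorem rebornMuDeriv_locE_le_of_coresAt_bipencil_mass_torus {W : Set (ℕ → ℝ)}
    {ctr : ℕ → (ℕ → ℝ) → C.BgB → Op × B13HistM P} {ROp RHist R' : ℕ → ℝ}
    (𝔊 : ∀ k i, C.Dom → BiCore P (dom k i) Op (β k i) (α k i)) {mq bq N₀ : ℕ → ι → C.Dom → ℝ} (hroom : ∀ k, ROp k < R' k)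
    (hm : ∀ k, ∀ g ∈ W, ∀ (U : C.BgB) (X : C.Dom), C.scale X = k → ∀ i, 0 < mq k i X)
    (hN : ∀ k, ∀ g ∈ W, ∀ (U : C.BgB) (X : C.Dom), C.scale X = k → ∀ i,
      (∀ o ∈ ball (ctr k g U).1 (R' k), AEStronglyMeasurable ((𝔊 k i X).N o) (𝔊 k i X).lam) ∧
      (∀ p, DifferentiableOn ℂ (fun o => (𝔊 k i X).N o p) (ball (ctr k g U).1 (R' k))) ∧
      (∀ o ∈ ball (ctr k g U).1 (R' k), ∀ p, ‖(𝔊 k i X).N o p‖ ≤ N₀ k i X))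
    (hq : ∀ k, ∀ g ∈ W, ∀ (U : C.BgB) (X : C.Dom), C.scale X = k → ∀ i,
      (∀ o ∈ ball (ctr k g U).1 (R' k),
        AEStronglyMeasurable (Function.uncurry ((𝔊 k i X).q o)) ((𝔊 k i X).lam.prod volume)) ∧
      (∀ p v, DifferentiableOn ℂ (fun o => (𝔊 k i X).q o p v) (ball (ctr k g U).1 (R' k))) ∧
      (∀ o ∈ ball (ctr k g U).1 (R' k), ∀ p v, mq k i X * ‖v‖ ^ 2 - bq k i X ≤ ((𝔊 k i X).q o p v).re))
    {k : ℕ} {g : ℕ → ℝ} (hg : g ∈ W) {U : C.BgB} {o : Op} {h₀ u v : B13HistM P} {μ₁ ε : ℝ}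
    (hv : 0 < ‖v‖) (hvε : ‖v‖ < ε)
    (hO : ‖o - (ctr k g U).1‖ ≤ ROp k) (hH : ‖h₀ - (ctr k g U).2‖ + μ₁ * ‖u‖ + ε ≤ RHist k)
    {emb : (tsys 4 N).Dom → C.Dom} (hscale : ∀ Z, C.scale (emb Z) = k) {terms : (tsys 4 N).Dom → Finset ι} {act : ℂ × ℂ → (tsys 4 N).Dom → ℂ}
    (hact : ∀ z ∈ ball (0 : ℂ) μ₁ ×ˢ ball (0 : ℂ) (ε / ‖v‖), ∀ Z,
      act z Z = ∑ i ∈ terms Z, (𝔊 k i (emb Z)).termAt o (h₀ + z.1 • u + z.2 • v))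
    {A R r₁ : ℝ} (X₀ : (tsys 4 N).Dom) (hA : 0 ≤ A) (hr₁ : 0 ≤ r₁)
    (hrate : r₁ + 2 * (64 * Real.log 162) + 2 ≤ R) (hsmall : A * Real.exp (5 * r₁ + 1) * K₀ 64 8 * 9 * 64 ≤ 1) (hM3 : ∀ Z : (tsys 4 N).Dom, Z.1 ⊆ X₀.1 →
      ∑ i ∈ terms Z, (𝔊 k i (emb Z)).lam.real univ * ((𝔊 k i (emb Z)).wB * N₀ k i (emb Z) *
          Real.exp (bq k i (emb Z))) * (Real.pi / (mq k i (emb Z) / 2)) ^ (Module.finrank ℝ (α k i) / 2 : ℝ) *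
        Real.exp ((𝔊 k i (emb Z)).N₁ * (‖h₀‖ + μ₁ * ‖u‖ + ε)) ≤ A * Real.exp (-(R * torusTreeLen Z.1)))
    {μ₀ : ℝ} (h01 : μ₀ < μ₁) {μ : ℂ} (hμ : ‖μ‖ ≤ μ₀) :
    ‖deriv (fun m : ℂ =>
        locE (Dom := (tsys 4 N).Dom) (TTouch (d := 4) (N := N)) (fun Z : (tsys 4 N).Dom => Z.1) (act (m, 1)) X₀.1 -
          locE (Dom := (tsys 4 N).Dom) (TTouch (d := 4) (N := N)) (fun Z : (tsys 4 N).Dom => Z.1) (act (m, 0)) X₀.1) μ‖ ≤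
      2 * (2 * (Real.exp 1 * 9 * 64 * K₀ 64 8 ^ 2 * A * Real.exp (-(r₁ * torusTreeLen X₀.1))) / ε * ‖v‖) / (μ₁ - μ₀)   := by
  obtain ⟨hν, hκ, hc⟩ := torus_consts N
  have hK₀ := K₀_four (N := N)
  have h := rebornMuDeriv_locE_le_of_coresAt_bipencil_mass (tsys 4 N) (tgeometry 4 N) 𝔊 hroom hm hN hq hg hv hvε hO hH hscale hact
    (R := R) (b₅ := 5 * r₁) (X₀ := X₀) hA hr₁ (le_of_eq (by ring)) (by rw [hκ]; exact hrate)
    (by rw [hK₀, hν, hc]; exact hsmall) hM3 h01 hμ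
  rw [hν, hc, hK₀] at h
  exact h

end Dep

end Summit.QuantumFields.BalabanUV.T4Continuum.NE1p.DressedRebornMuPartTorus

end
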